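import Mathlib.LinearAlgebra.Matrix.NonsingularInverse
import Mathlib.LinearAlgebra.Matrix.Trace
import Mathlib.Data.Matrix.Basis
import Mathlib.Data.Complex.Basic
import HarnessLib

/-!
# Signed perfect-matching matrices `J(π,s)` (the sparse invertible skew test matrices of LMR13 §3.5's route)

[topic Computability/AlgebraicComplexity]

For a fixed-point-free involution `π` of a finite index type and weights `s` with `s (π a) = −s a`, the matrix
`J(π,s)_{ab} := [π a = b]·s_a` is skew-symmetric and monomial; `J(π,s)·J(π,u)` is diagonal, so `J(π,s)` is
invertible with inverse `J(π, −1/s)`, and `tr(J(π,u)·N) = Σ_a u_a N_{πa,a}`. Changing the weight on ONE pair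
`{a, πa}` changes `J(π,s)` by a multiple of the elementary skew matrix `E_{a,πa} − E_{πa,a}` ("pair-difference").
These are the matrices `Ω` of the sparse corank-one points `R_r(Ω)` (`SkewAdjugateFirstOrder.padAt`) of the
elementary route to the stabiliser bound of Landsberg–Manivel–Ressayre 2013, Prop. 3.5.1 (journal p. 481:
"we compute the stabilizer of `P_Λ` inside `GL(M_n(ℂ))` … it has dimension `2n²`"); cell val-lit memo
`HOME/lmr/X3b-ELEMENTARY-ROUTE-t10g4.md` §1. A standard fixed-point-free involution of `Fin (h + h)` is
`halfSwap` (exchange of the two halves).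

Everything is PROVED; no named fact. Honest framing: infrastructure only; VP ≠ VNP is NOT proved and nothing here
is progress on it.

## References

* [LandsbergManivelRessayre2013] J. M. Landsberg, L. Manivel, N. Ressayre, *Hypersurfaces with degenerate duals and
  the geometric complexity theory program*, Comment. Math. Helv. 88 (2013) 469–484, §3.5 (p. 481).
-/

noncomputable section

open Matrix

namespace Literature.Computability.AlgebraicComplexity

namespace SkewAdj

universe u

variable {ι : Type u} [DecidableEq ι]

/-- **`J(π,s)`**: the signed matching matrix `J(π,s)_{ab} = [π a = b]·s_a` of a permutation `π` with weights
`s` (skew and invertible when `π` is a fixed-point-free involution and `s (π a) = −s a ≠ 0`).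
[cite: LandsbergManivelRessayre2013, §3.5 (p. 481)] -/
def pairMat (π : Equiv.Perm ι) (s : ι → ℂ) : Matrix ι ι ℂ :=
  Matrix.of fun a b => if π a = b then s a else 0

/-- Entries of `J(π,s)`. [cite: LandsbergManivelRessayre2013, §3.5 (p. 481)] -/
theorem pairMat_apply (π : Equiv.Perm ι) (s : ι → ℂ) (a b : ι) :
    pairMat π s a b = if π a = b then s a else 0 := rfl

/-- The entry of `J(π,s)` on the pair `(a, πa)`. [cite: LandsbergManivelRessayre2013, §3.5 (p. 481)] -/
@[simp]
theorem pairMat_apply_pair (π : Equiv.Perm ι) (s : ι → ℂ) (a : ι) : pairMat π s a (π a) = s a := by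
  rw [pairMat_apply, if_pos rfl]

/-- Off the matching, `J(π,s)` vanishes. [cite: LandsbergManivelRessayre2013, §3.5 (p. 481)] -/
theorem pairMat_apply_of_ne (π : Equiv.Perm ι) (s : ι → ℂ) {a b : ι} (h : π a ≠ b) : pairMat π s a b = 0 := by
  rw [pairMat_apply, if_neg h]

/-- `J(π,s)` is skew-symmetric for a (fixed-point-free) involution `π` and antisymmetric weights.
[cite: LandsbergManivelRessayre2013, §3.5 (p. 481)] -/
theorem pairMat_transpose {π : Equiv.Perm ι} (hπ : ∀ a, π (π a) = a) {s : ι → ℂ} (hs : ∀ a, s (π a) = -s a) :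
    (pairMat π s)ᵀ = -pairMat π s := by
  ext a b
  rw [Matrix.transpose_apply, Matrix.neg_apply, pairMat_apply, pairMat_apply]
  by_cases h : π a = b
  · subst h
    rw [if_pos (hπ a), if_pos rfl, hs]
  · have h' : π b ≠ a := fun h' => h (by rw [← h', hπ])
    rw [if_neg h', if_neg h, neg_zero]

variable [Fintype ι]

/-- `J(π,s)·J(π,u)` is diagonal for an involution `π`. [cite: LandsbergManivelRessayre2013, §3.5 (p. 481)] -/
theorem pairMat_mul_pairMat {π : Equiv.Perm ι} (hπ : ∀ a, π (π a) = a) (s u : ι → ℂ) :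
    pairMat π s * pairMat π u = Matrix.diagonal fun a => s a * u (π a) := by
  ext a b
  rw [Matrix.mul_apply, Fintype.sum_eq_single (π a) (fun c hc => by rw [pairMat_apply_of_ne π s (Ne.symm hc), zero_mul]),
    pairMat_apply_pair, pairMat_apply, hπ, Matrix.diagonal_apply]
  split_ifs <;> simp

/-- **`J(π,s)⁻¹ = J(π,−1/s)`**: the explicit inverse for non-vanishing antisymmetric weights.
[cite: LandsbergManivelRessayre2013, §3.5 (p. 481)] -/
theorem pairMat_mul_pairMat_neg_inv {π : Equiv.Perm ι} (hπ : ∀ a, π (π a) = a) {s : ι → ℂ}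
    (hs : ∀ a, s (π a) = -s a) (hs0 : ∀ a, s a ≠ 0) :
    pairMat π s * pairMat π (fun a => -(s a)⁻¹) = 1 := by
  rw [pairMat_mul_pairMat hπ]
  convert Matrix.diagonal_one with a
  rw [hs, inv_neg, neg_neg, mul_inv_cancel₀ (hs0 a)]

/-- `J(π,s)` is invertible. [cite: LandsbergManivelRessayre2013, §3.5 (p. 481)] -/
theorem isUnit_det_pairMat {π : Equiv.Perm ι} (hπ : ∀ a, π (π a) = a) {s : ι → ℂ}
    (hs : ∀ a, s (π a) = -s a) (hs0 : ∀ a, s a ≠ 0) : IsUnit (pairMat π s).det := by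
  exact Matrix.isUnit_det_of_right_inverse (pairMat_mul_pairMat_neg_inv hπ hs hs0)

/-- The inverse of `J(π,s)`. [cite: LandsbergManivelRessayre2013, §3.5 (p. 481)] -/
theorem pairMat_inv {π : Equiv.Perm ι} (hπ : ∀ a, π (π a) = a) {s : ι → ℂ}
    (hs : ∀ a, s (π a) = -s a) (hs0 : ∀ a, s a ≠ 0) :
    (pairMat π s)⁻¹ = pairMat π (fun a => -(s a)⁻¹) :=
  Matrix.inv_eq_right_inv (pairMat_mul_pairMat_neg_inv hπ hs hs0)

/-- **`tr(J(π,u)·N) = Σ_a u_a · N_{πa,a}`.** [cite: LandsbergManivelRessayre2013, §3.5 (p. 481)] -/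
theorem trace_pairMat_mul (π : Equiv.Perm ι) (u : ι → ℂ) (N : Matrix ι ι ℂ) :
    Matrix.trace (pairMat π u * N) = ∑ a, u a * N (π a) a := by
  simp only [Matrix.trace, Matrix.diag, Matrix.mul_apply]
  refine Finset.sum_congr rfl fun a _ => ?_
  rw [Fintype.sum_eq_single (π a) (fun c hc => by rw [pairMat_apply_of_ne π u (Ne.symm hc), zero_mul]),
    pairMat_apply_pair]

omit [Fintype ι] in
/-- Weights changed on the single pair `{a₀, π a₀}` by the factor `2` (still antisymmetric and non-zero).
[cite: LandsbergManivelRessayre2013, §3.5 (p. 481)] -/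
def bumpWeight (π : Equiv.Perm ι) (s : ι → ℂ) (a₀ : ι) : ι → ℂ :=
  fun a => if a = a₀ ∨ a = π a₀ then 2 * s a else s a

omit [Fintype ι] in
/-- The bumped weights are antisymmetric. [cite: LandsbergManivelRessayre2013, §3.5 (p. 481)] -/
theorem bumpWeight_antisymm {π : Equiv.Perm ι} (hπ : ∀ a, π (π a) = a) {s : ι → ℂ}
    (hs : ∀ a, s (π a) = -s a) (a₀ a : ι) : bumpWeight π s a₀ (π a) = -bumpWeight π s a₀ a := by
  unfold bumpWeight
  have key : (π a = a₀ ∨ π a = π a₀) ↔ (a = a₀ ∨ a = π a₀) := by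
    constructor
    · rintro (h | h)
      · right; rw [← h, hπ]
      · left; exact π.injective h
    · rintro (h | h)
      · right; rw [h]
      · left; rw [h, hπ]
  by_cases h : a = a₀ ∨ a = π a₀
  · rw [if_pos (key.2 h), if_pos h, hs]; ring
  · rw [if_neg (fun h' => h (key.1 h')), if_neg h, hs]

omit [Fintype ι] in
/-- The bumped weights do not vanish. [cite: LandsbergManivelRessayre2013, §3.5 (p. 481)] -/
theorem bumpWeight_ne_zero (π : Equiv.Perm ι) {s : ι → ℂ} (hs0 : ∀ a, s a ≠ 0) (a₀ a : ι) :
    bumpWeight π s a₀ a ≠ 0 := by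
  unfold bumpWeight
  split_ifs
  · exact mul_ne_zero two_ne_zero (hs0 a)
  · exact hs0 a

omit [Fintype ι] in
/-- **Pair-difference**: bumping the weight of the pair `{a₀, πa₀}` changes `J(π,s)` by
`s_{a₀} · (E_{a₀,πa₀} − E_{πa₀,a₀})`. [cite: LandsbergManivelRessayre2013, §3.5 (p. 481)] -/
theorem pairMat_bumpWeight_sub {π : Equiv.Perm ι} (hπ : ∀ a, π (π a) = a) (hfix : ∀ a, π a ≠ a)
    {s : ι → ℂ} (hs : ∀ a, s (π a) = -s a) (a₀ : ι) :
    pairMat π (bumpWeight π s a₀) - pairMat π s =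
      s a₀ • (Matrix.single a₀ (π a₀) (1 : ℂ) - Matrix.single (π a₀) a₀ (1 : ℂ)) := by
  ext a b
  rw [Matrix.sub_apply, pairMat_apply, pairMat_apply, Matrix.smul_apply, Matrix.sub_apply, smul_eq_mul]
  unfold bumpWeight
  by_cases hab : π a = b
  · subst hab
    rw [if_pos rfl, if_pos rfl]
    by_cases h : a = a₀ ∨ a = π a₀
    · rw [if_pos h]
      rcases h with rfl | rfl
      · rw [Matrix.single_apply_same, Matrix.single_apply_of_row_ne (hfix a), sub_zero, mul_one]
        ring
      · rw [hπ, Matrix.single_apply_same, Matrix.single_apply_of_row_ne (Ne.symm (hfix a₀)), zero_sub, hs]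
        ring
    · rw [if_neg h, sub_self]
      push Not at h
      rw [Matrix.single_apply_of_row_ne (Ne.symm h.1), Matrix.single_apply_of_row_ne (Ne.symm h.2), sub_zero,
        mul_zero]
  · rw [if_neg hab, if_neg hab, sub_self]
    have h1 : Matrix.single a₀ (π a₀) (1 : ℂ) a b = 0 := by
      by_cases ha : a₀ = a
      · subst ha
        exact Matrix.single_apply_of_col_ne _ _ hab _
      · exact Matrix.single_apply_of_row_ne ha _ _ _
    have h2 : Matrix.single (π a₀) a₀ (1 : ℂ) a b = 0 := by
      by_cases ha : π a₀ = a
      · subst ha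
        rw [hπ] at hab
        exact Matrix.single_apply_of_col_ne _ _ hab _
      · exact Matrix.single_apply_of_row_ne ha _ _ _
    rw [h1, h2, sub_zero, mul_zero]

end SkewAdj

/-! ### A fixed-point-free involution of `Fin (h + h)` -/

namespace SkewAdj

/-- The exchange of the two halves of `Fin (h + h)`: a fixed-point-free involution.
[cite: LandsbergManivelRessayre2013, §3.5 (p. 481)] -/
def halfSwap (h : ℕ) : Equiv.Perm (Fin (h + h)) :=
  (finSumFinEquiv.symm.trans (Equiv.sumComm (Fin h) (Fin h))).trans finSumFinEquiv

/-- `halfSwap` is an involution. [cite: LandsbergManivelRessayre2013, §3.5 (p. 481)] -/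
theorem halfSwap_halfSwap (h : ℕ) (a : Fin (h + h)) : halfSwap h (halfSwap h a) = a := by
  simp [halfSwap]

/-- `halfSwap` has no fixed point. [cite: LandsbergManivelRessayre2013, §3.5 (p. 481)] -/
theorem halfSwap_ne (h : ℕ) (a : Fin (h + h)) : halfSwap h a ≠ a := by
  unfold halfSwap
  intro hab
  have := congrArg finSumFinEquiv.symm hab
  simp only [Equiv.trans_apply, Equiv.symm_apply_apply, Equiv.sumComm_apply] at this
  rcases hx : finSumFinEquiv.symm a with i | i
  · rw [hx] at this; exact Sum.inr_ne_inl this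
  · rw [hx] at this; exact Sum.inl_ne_inr this

/-- Conjugates of a fixed-point-free involution are fixed-point-free involutions.
[cite: LandsbergManivelRessayre2013, §3.5 (p. 481)] -/
theorem conj_involutive_fixedPointFree {ι : Type*} {π : Equiv.Perm ι} (hπ : ∀ a, π (π a) = a)
    (hfix : ∀ a, π a ≠ a) (σ : Equiv.Perm ι) :
    (∀ a, (σ * π * σ⁻¹) ((σ * π * σ⁻¹) a) = a) ∧ ∀ a, (σ * π * σ⁻¹) a ≠ a := by
  refine ⟨fun a => ?_, fun a h => ?_⟩
  · simp [Equiv.Perm.mul_apply, hπ]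
  · simp only [Equiv.Perm.mul_apply] at h
    apply hfix (σ⁻¹ a)
    simpa using congrArg (⇑σ⁻¹) h

/-- **A fixed-point-free involution with a prescribed pair**: for `a ≠ b` in `Fin (h + h)` there is a
fixed-point-free involution `π` with `π a = b`. [cite: LandsbergManivelRessayre2013, §3.5 (p. 481)] -/
theorem exists_involution_apply_eq {h : ℕ} {a b : Fin (h + h)} (hab : a ≠ b) :
    ∃ π : Equiv.Perm (Fin (h + h)), (∀ x, π (π x) = x) ∧ (∀ x, π x ≠ x) ∧ π a = b := by
  set π₀ := halfSwap h with hπ₀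
  -- conjugate `π₀` so that its pair `{a, π₀ a}` becomes `{a, b}`
  set b₁ := Equiv.swap (π₀ a) b with hb₁
  refine ⟨b₁ * π₀ * b₁⁻¹, (conj_involutive_fixedPointFree (halfSwap_halfSwap h) (halfSwap_ne h) b₁).1,
    (conj_involutive_fixedPointFree (halfSwap_halfSwap h) (halfSwap_ne h) b₁).2, ?_⟩
  have ha : b₁⁻¹ a = a := by
    rw [hb₁, Equiv.swap_inv, Equiv.swap_apply_of_ne_of_ne (Ne.symm (halfSwap_ne h a)) hab]
  rw [Equiv.Perm.mul_apply, Equiv.Perm.mul_apply, ha, hb₁, Equiv.swap_apply_left]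

end SkewAdj

end Literature.Computability.AlgebraicComplexity

end
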